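import Literature.InformationTheory.QuantumCodes.QuantumExpanderCodeParameters
import Literature.InformationTheory.QuantumCodes.HypergraphProductThresholds
import HarnessLib

/-!
# Certified thresholds for quantum expander code FAMILIES under minimum-weight decoding
# (expansion ⇒ linear sector distance ⇒ Dumer–Kovalev–Pryadko thresholds)

Topic `Literature/InformationTheory/QuantumCodes` (venture QEC, LADDER-QEC rung Q5, "LDPC families beyond
the toric code"). PROVED, no named fact, kernel axioms. For a FAMILY of `(Δ_A, Δ_B)`-biregular
(`Δ_A, Δ_B ≥ 1`), `(γ_A, δ_A, γ_B, δ_B)`-left-right-expanding bipartite graphs `G_i = (A_i ∪ B_i, ℰ_i)`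
with `δ_A, δ_B < 1/2`, `γ_A, γ_B > 0` and `n_A(i) = |A_i| → ∞` (the hypotheses of Leverrier–Tillich–Zémor
2015 §2, weakened from `δ < 1/6` to `δ < 1/2`), the quantum expander codes `Q_{G_i}`
(`expanderHX (H i)`, `expanderHZ (H i)` of `QuantumExpanderCodes.lean`) satisfy:

* every check has weight `≤ Δ_A + Δ_B` (`QuantumExpander.hammingNorm_expanderHX_row_le`);
* every logical operator has weight `> min(γ_A n_A, γ_B n_B) = c · n_A` with
  `c = min(γ_A, γ_B Δ_A/Δ_B) > 0` (LTZ15 Cor. 5, `QuantumExpander.floor_succ_le_cssMinDist`, and the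
  biregular edge count `n_A Δ_A = n_B Δ_B`);
* `|Q_i| = n_A² + n_B² = (1 + (Δ_A/Δ_B)²) n_A²` — polynomial, while the distance is LINEAR in `n_A`;

hence the tree's Dumer–Kovalev–Pryadko threshold theorems in type-family form
(`HypergraphProductThresholds.lean`: `codeCapacityThreshold_of_rowWeight'`, `erasureThreshold_of_rowWeight'`,
`phenomThreshold_of_rowWeight'`) apply with `w = Δ_A + Δ_B`:

* `expander_codeCapacityThreshold` — independent errors of the sector detected by `H_X`, EVERY family of
  minimum-weight decoders: `4(Δ_A+Δ_B−1)² p(1−p) < 1` ⇒ `Prob_fail → 0`;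
* `expander_erasureThreshold` — erasure rate `(Δ_A+Δ_B−1) y < 1` ⇒ `Prob[uncorrectable] → 0`;
* `expander_phenomThreshold` — noisy syndrome `q = p`, `T_i ≤ M n_A(i)^m` rounds, EVERY family of
  minimum-weight space-time decoders: `4(Δ_A+Δ_B+1)² p(1−p) < 1` ⇒ `Prob_fail → 0`.

The `Z`-sector / other labelling is the same statement for the reversed graphs `(H i)ᵀ` (which form a
`(Δ_B, Δ_A)`-biregular `(γ_B, δ_B, γ_A, δ_A)`-expanding family) and is not repeated. Honest framing: these
are thresholds for (inefficient) MINIMUM-WEIGHT decoding, a consequence of DKP15 Thm 2/3 (proved in the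
tree) and of the expansion distance bound; they are NOT the Leverrier–Tillich–Zémor / Fawzi–Grospellier–
Leverrier statements about the efficient small-set-flip decoder (`LTZ15_theorem2_pos`, `FGL18_theorem1`,
statement-only named facts), whose expansion requirement is the stronger `δ < 1/6` resp. `β₀ > 0`.
Non-vacuity of the family hypotheses (biregular expander families with `δ_A, δ_B < 1/2` — indeed with
`δ` arbitrarily small once `Δ_A, Δ_B` are large — and `n_A → ∞` EXIST) is the classical random-graph fact
that LTZ15 quotes as [Bas81, SS96] (FGL18 Thm 4); it is neither assumed nor proved in this file, whose
theorems are implications quantified over all such families.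

References: [LeverrierTillichZemor2015] arXiv:1504.00822, §2 (the family; "the rate of the quantum code
`Q_G` is bounded from below by a non-zero constant and its typical minimum distance … proportional to
`min(γ_A n_A, γ_B n_B)`", p0006 L3-5, L27-28) and Cor. 5 (p0008); [DumerKovalevPryadko2015] I. Dumer,
A. A. Kovalev, L. P. Pryadko, PRL 115 (2015) 050502, Thm 2, Thm 3 ("any family of quantum LDPC codes
with distance growing … has a threshold"); [TillichZemor2014] Thm 9.
-/

namespace Literature.InformationTheory.QuantumCodes

namespace QuantumExpander

open Finset Matrix Filter Topology

/-! ### Growth lemma: polynomial size, linear distance -/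

/-- `K n^m r^{⌊c n⌋+1} → 0` along any `n_i → ∞` (`0 < r < 1`, `c > 0`): the size/distance trade-off of
the expander family. [cite: DumerKovalevPryadko2015, Thm 2 (hypothesis: distance growing at least logarithmically; here linearly)] -/
theorem tendsto_pow_mul_pow_floor_succ (n : ℕ → ℕ) (hn : Tendsto n atTop atTop) {K c r : ℝ}
    (hK : 0 ≤ K) (hc : 0 < c) (hr0 : 0 < r) (hr1 : r < 1) (m : ℕ) :
    Tendsto (fun i => K * (n i : ℝ) ^ m * r ^ (⌊c * n i⌋₊ + 1)) atTop (𝓝 0) := by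
  -- `ρ = r^c ∈ (0,1)` and `r^{⌊c n⌋ + 1} ≤ ρ^n`
  set ρ : ℝ := r ^ c with hρ
  have hρ0 : 0 < ρ := Real.rpow_pos_of_pos hr0 c
  have hρ1 : ρ < 1 := Real.rpow_lt_one hr0.le hr1 hc
  have hstep : ∀ k : ℕ, r ^ (⌊c * k⌋₊ + 1) ≤ ρ ^ k := by
    intro k
    have h1 : (r ^ (⌊c * (k : ℝ)⌋₊ + 1) : ℝ) = r ^ (((⌊c * (k : ℝ)⌋₊ + 1 : ℕ) : ℝ)) :=
      (Real.rpow_natCast r _).symm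
    have h2 : ρ ^ k = r ^ (c * (k : ℝ)) := by
      rw [hρ, ← Real.rpow_natCast, ← Real.rpow_mul hr0.le]
    rw [h1, h2]
    refine Real.rpow_le_rpow_of_exponent_ge hr0 hr1.le ?_
    have := Nat.lt_floor_add_one (c * (k : ℝ))
    push_cast
    linarith
  -- `K n^m ρ^n → 0` along `n → ∞`, then along `n_i`
  have hlim : Tendsto (fun k : ℕ => K * ((k : ℝ) ^ m * ρ ^ k)) atTop (𝓝 0) := by
    have h := (tendsto_pow_const_mul_const_pow_of_abs_lt_one m
      (show |ρ| < 1 by rwa [abs_of_nonneg hρ0.le])).const_mul K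
    rwa [mul_zero] at h
  have hcomp := hlim.comp hn
  refine squeeze_zero (fun i => by positivity) (fun i => ?_) hcomp
  simp only [Function.comp]
  rw [mul_assoc]
  exact mul_le_mul_of_nonneg_left
    (mul_le_mul_of_nonneg_left (hstep (n i)) (by positivity)) hK

/-! ### The expander family -/

variable {A B : ℕ → Type*} [∀ i, Fintype (A i)] [∀ i, Fintype (B i)]
  [∀ i, DecidableEq (A i)] [∀ i, DecidableEq (B i)]

/-- In a `(Δ_A, Δ_B)`-biregular family the distance parameter is `⌊c n_A⌋ + 1` with
`c = min(γ_A, γ_B Δ_A / Δ_B)`, because `n_B = n_A Δ_A / Δ_B`.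
[cite: LeverrierTillichZemor2015, §2 (biregular; arXiv v1 p0005 L5-8)] -/
theorem min_eq_mul_card_of_isBiregular {A' B' : Type*} [Fintype A'] [Fintype B'] [DecidableEq A']
    [DecidableEq B'] (H : Matrix B' A' (ZMod 2)) {dA dB : ℕ} (hreg : IsBiregular H dA dB) (hdB : 0 < dB)
    (γA γB : ℝ) :
    min (γA * Fintype.card A') (γB * Fintype.card B')
      = min γA (γB * dA / dB) * Fintype.card A' := by
  have hcount := card_mul_eq_card_mul_of_isBiregular H hreg
  have hB : (Fintype.card B' : ℝ) = (Fintype.card A' : ℝ) * dA / dB := by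
    have hdB' : (dB : ℝ) ≠ 0 := by exact_mod_cast hdB.ne'
    field_simp
    exact_mod_cast hcount.symm
  rw [hB, min_mul_of_nonneg _ _ (Nat.cast_nonneg _)]
  congr 1
  ring

/-- The size of `Q_G` in a biregular family: `|Q| = n_A² + n_B² = (1 + (Δ_A/Δ_B)²) n_A²`.
[cite: LeverrierTillichZemor2015, §2 eq. (4) (n = n_A² + n_B²)] -/
theorem card_qubits_eq_of_isBiregular {A' B' : Type*} [Fintype A'] [Fintype B'] [DecidableEq A']
    [DecidableEq B'] (H : Matrix B' A' (ZMod 2)) {dA dB : ℕ} (hreg : IsBiregular H dA dB) (hdB : 0 < dB) :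
    (Fintype.card ((A' × A') ⊕ (B' × B')) : ℝ)
      = (1 + ((dA : ℝ) / dB) ^ 2) * (Fintype.card A' : ℝ) ^ 2 := by
  have hcount := card_mul_eq_card_mul_of_isBiregular H hreg
  have hB : (Fintype.card B' : ℝ) = (Fintype.card A' : ℝ) * dA / dB := by
    have hdB' : (dB : ℝ) ≠ 0 := by exact_mod_cast hdB.ne'
    field_simp
    exact_mod_cast hcount.symm
  rw [card_qubits]
  push_cast
  rw [hB]
  have hdB' : (dB : ℝ) ≠ 0 := by exact_mod_cast hdB.ne'
  field_simp

/-- The growth hypothesis of the DKP15 theorems for the expander family: `|Q_i| r^{d_i} → 0` for every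
`0 < r < 1`, from `n_A(i) → ∞` (polynomial size, linear distance).
[cite: DumerKovalevPryadko2015, Thm 2 (distance growth hypothesis)] -/
theorem tendsto_card_mul_pow_dist (H : ∀ i, Matrix (B i) (A i) (ZMod 2)) {dA dB : ℕ}
    {γA γB : ℝ} (hreg : ∀ i, IsBiregular (H i) dA dB) (hdA : 0 < dA) (hdB : 0 < dB)
    (hγA : 0 < γA) (hγB : 0 < γB) (hgrow : Tendsto (fun i => Fintype.card (A i)) atTop atTop)
    {r : ℝ} (hr0 : 0 < r) (hr1 : r < 1) :
    Tendsto (fun i => (Fintype.card ((A i × A i) ⊕ (B i × B i)) : ℝ) * r ^ (⌊min (γA * Fintype.card (A i)) (γB * Fintype.card (B i))⌋₊ + 1))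
      atTop (𝓝 0) := by
  have hc : 0 < min γA (γB * dA / dB) := lt_min hγA (by positivity)
  have h := tendsto_pow_mul_pow_floor_succ (fun i => Fintype.card (A i)) hgrow
    (K := 1 + ((dA : ℝ) / dB) ^ 2) (by positivity) hc hr0 hr1 2
  refine h.congr fun i => ?_
  rw [card_qubits_eq_of_isBiregular (H i) (hreg i) hdB, min_eq_mul_card_of_isBiregular (H i) (hreg i) hdB]

/-- The growth hypothesis of the phenomenological theorem: `(|Q_i| + |C_i|) T_i r^{d_i} → 0` when the
number of rounds is polynomial in `n_A(i)` (`T_i ≤ M n_A(i)^m`).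
[cite: DumerKovalevPryadko2015, Thm 3 (space-time code of N(T+1)… qubits)] -/
theorem tendsto_card_mul_rounds_mul_pow_dist (H : ∀ i, Matrix (B i) (A i) (ZMod 2)) {dA dB : ℕ}
    {γA γB : ℝ} (hreg : ∀ i, IsBiregular (H i) dA dB) (hdA : 0 < dA) (hdB : 0 < dB)
    (hγA : 0 < γA) (hγB : 0 < γB) (hgrow : Tendsto (fun i => Fintype.card (A i)) atTop atTop)
    (T : ℕ → ℕ) {M : ℝ} {m : ℕ} (hM : 0 ≤ M) (hT : ∀ i, (T i : ℝ) ≤ M * (Fintype.card (A i) : ℝ) ^ m)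
    {r : ℝ} (hr0 : 0 < r) (hr1 : r < 1) :
    Tendsto (fun i => (((Fintype.card ((A i × A i) ⊕ (B i × B i)) + Fintype.card (A i × B i)) * T i
        : ℕ) : ℝ) * r ^ (⌊min (γA * Fintype.card (A i)) (γB * Fintype.card (B i))⌋₊ + 1)) atTop (𝓝 0) := by
  have hc : 0 < min γA (γB * dA / dB) := lt_min hγA (by positivity)
  -- `(|Q| + |C|) T ≤ (1 + (Δ_A/Δ_B)² + Δ_A/Δ_B) n_A² · M n_A^m`
  set K : ℝ := (1 + ((dA : ℝ) / dB) ^ 2 + (dA : ℝ) / dB) * M with hK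
  have hK0 : 0 ≤ K := by positivity
  have h := tendsto_pow_mul_pow_floor_succ (fun i => Fintype.card (A i)) hgrow hK0 hc hr0 hr1 (2 + m)
  refine squeeze_zero (fun i => by positivity) (fun i => ?_) h
  rw [min_eq_mul_card_of_isBiregular (H i) (hreg i) hdB]
  refine mul_le_mul_of_nonneg_right ?_ (pow_nonneg hr0.le _)
  have hQ := card_qubits_eq_of_isBiregular (H i) (hreg i) hdB
  have hcount := card_mul_eq_card_mul_of_isBiregular (H i) (hreg i)
  have hBcard : (Fintype.card (B i) : ℝ) = (Fintype.card (A i) : ℝ) * dA / dB := by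
    have hdB' : (dB : ℝ) ≠ 0 := by exact_mod_cast hdB.ne'
    field_simp
    exact_mod_cast hcount.symm
  have hC : (Fintype.card (A i × B i) : ℝ) = (dA : ℝ) / dB * (Fintype.card (A i) : ℝ) ^ 2 := by
    rw [Fintype.card_prod]; push_cast; rw [hBcard]; ring
  have hn : (0 : ℝ) ≤ Fintype.card (A i) := Nat.cast_nonneg _
  push_cast
  rw [hQ, hC, hK, pow_add]
  have hsum : (1 + ((dA : ℝ) / dB) ^ 2) * (Fintype.card (A i) : ℝ) ^ 2
      + (dA : ℝ) / dB * (Fintype.card (A i) : ℝ) ^ 2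
      = (1 + ((dA : ℝ) / dB) ^ 2 + (dA : ℝ) / dB) * (Fintype.card (A i) : ℝ) ^ 2 := by ring
  rw [hsum]
  have hpos : 0 ≤ (1 + ((dA : ℝ) / dB) ^ 2 + (dA : ℝ) / dB) * (Fintype.card (A i) : ℝ) ^ 2 := by
    positivity
  calc (1 + ((dA : ℝ) / dB) ^ 2 + (dA : ℝ) / dB) * (Fintype.card (A i) : ℝ) ^ 2 * (T i : ℝ)
      ≤ (1 + ((dA : ℝ) / dB) ^ 2 + (dA : ℝ) / dB) * (Fintype.card (A i) : ℝ) ^ 2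
          * (M * (Fintype.card (A i) : ℝ) ^ m) := mul_le_mul_of_nonneg_left (hT i) hpos
    _ = (1 + ((dA : ℝ) / dB) ^ 2 + (dA : ℝ) / dB) * M
          * ((Fintype.card (A i) : ℝ) ^ 2 * (Fintype.card (A i) : ℝ) ^ m) := by ring

/-- Check weights of the family: every row of `H_X(G_i)` involves at most `Δ_A + Δ_B` qubits.
[cite: LeverrierTillichZemor2015, §2 (constant row weight Δ_A + Δ_B; arXiv v1 p0005 L77-78)] -/
theorem card_rowSupp_expanderHX_le {A' B' : Type*} [Fintype A'] [Fintype B'] [DecidableEq A']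
    [DecidableEq B'] (H : Matrix B' A' (ZMod 2)) {dA dB : ℕ} (hreg : IsBiregular H dA dB) (j : A' × B') :
    (rowSupp (expanderHX H) j).card ≤ dA + dB := by
  rw [card_rowSupp_eq_hammingNorm]
  obtain ⟨α, β⟩ := j
  exact hammingNorm_expanderHX_row_le H hreg α β

/-- Sector distance of the family (LTZ15 Cor. 5): every `x` with `H_X x = 0`, `x ∉ rowsp H_Z` has weight
`≥ d_i = ⌊min(γ_A n_A, γ_B n_B)⌋ + 1`. [cite: LeverrierTillichZemor2015, Cor. 5 (arXiv v1 p0008 L40-45)] -/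
theorem dist_le_hammingNorm {A' B' : Type*} [Fintype A'] [Fintype B'] [DecidableEq A'] [DecidableEq B']
    (H : Matrix B' A' (ZMod 2)) {dA dB : ℕ} {γA δA γB δB : ℝ} (hreg : IsBiregular H dA dB)
    (hdA : 0 < dA) (hdB : 0 < dB) (hexp : IsLeftRightExpanding H dA dB γA δA γB δB) (hδA : δA < 1 / 2)
    (hδB : δB < 1 / 2) (x : (A' × A') ⊕ (B' × B') → ZMod 2) (hx : expanderHX H *ᵥ x = 0)
    (hnot : x ∉ rowSpace (expanderHZ H)) :
    ⌊min (γA * Fintype.card A') (γB * Fintype.card B')⌋₊ + 1 ≤ hammingNorm x := by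
  have h := (floor_succ_le_cssMinDist H (fun a => (hreg.1 a).le) (fun b => (hreg.2 b).le) hdA hdB hexp
    hδA hδB).trans (cssMinDist_le_hammingNorm (Or.inl ⟨(mem_pcCode_iff _ _).2 hx, hnot⟩))
  exact_mod_cast h

/-! ### The three certified thresholds -/

open Classical in
/-- **Certified code-capacity threshold of every quantum expander family** (independent errors of the
sector detected by `H_X`, EVERY family of minimum-weight decoders): for a `(Δ_A, Δ_B)`-biregular
(`Δ ≥ 1`) `(γ_A, δ_A, γ_B, δ_B)`-expanding family with `δ_A, δ_B < 1/2`, `γ_A, γ_B > 0`, `n_A → ∞`: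
`4(Δ_A+Δ_B−1)² p(1−p) < 1` (i.e. `p < p₀(Δ_A+Δ_B−1)`) ⇒ `Prob_fail → 0`. PROVED, unconditional.
[cite: DumerKovalevPryadko2015, Thm 2 (y = 0; w = Δ_A + Δ_B)] [cite: LeverrierTillichZemor2015, §2 and Cor. 5] -/
theorem expander_codeCapacityThreshold (H : ∀ i, Matrix (B i) (A i) (ZMod 2)) {dA dB : ℕ}
    {γA δA γB δB : ℝ} (hreg : ∀ i, IsBiregular (H i) dA dB)
    (hexp : ∀ i, IsLeftRightExpanding (H i) dA dB γA δA γB δB) (hdA : 0 < dA) (hdB : 0 < dB)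
    (hγA : 0 < γA) (hγB : 0 < γB) (hδA : δA < 1 / 2) (hδB : δB < 1 / 2)
    (hgrow : Tendsto (fun i => Fintype.card (A i)) atTop atTop)
    (D : ∀ i, Decoder (A i × B i → ZMod 2) ((A i × A i) ⊕ (B i × B i) → ZMod 2))
    (hD : ∀ i, (D i).IsMinWeight (fun e => expanderHX (H i) *ᵥ e) {x | expanderHX (H i) *ᵥ x = 0}
      hammingNorm)
    {p : ℝ} (hp0 : 0 ≤ p) (hp : p ≤ 1 / 2)
    (h4 : 4 * ((dA + dB - 1 : ℕ) : ℝ) ^ 2 * (p * (1 - p)) < 1) :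
    Tendsto (fun i => ∑ e ∈ univ.filter (fun e : (A i × A i) ⊕ (B i × B i) → ZMod 2 =>
        ¬ (D i).Corrects (fun e => expanderHX (H i) *ᵥ e)
          (rowSpace (expanderHZ (H i)) : Set ((A i × A i) ⊕ (B i × B i) → ZMod 2)) e),
        bernoulliWeight p (supp e)) atTop (𝓝 0) :=
  codeCapacityThreshold_of_rowWeight' (fun i => expanderHX (H i)) (fun i => rowSpace (expanderHZ (H i)))
    D hD (w := dA + dB) (by omega) (fun i j => card_rowSupp_expanderHX_le (H i) (hreg i) j)
    (fun i => (⌊min (γA * Fintype.card (A i)) (γB * Fintype.card (B i))⌋₊ + 1)) (fun _ => Nat.succ_pos _)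
    (fun i x hx hnot => dist_le_hammingNorm (H i) (hreg i) hdA hdB (hexp i) hδA hδB x hx hnot)
    (fun _ hr0 hr1 => tendsto_card_mul_pow_dist H hreg hdA hdB hγA hγB hgrow hr0 hr1) hp0 hp h4

/-- **Certified erasure threshold of every quantum expander family**: with the same hypotheses, for
every loss rate `0 ≤ y` with `(Δ_A+Δ_B−1) y < 1` the probability that the erasure pattern is
uncorrectable (for the `H_X`-sector) `→ 0`. PROVED, unconditional.
[cite: DumerKovalevPryadko2015, Thm 2 (erasure part; w = Δ_A + Δ_B)] [cite: LeverrierTillichZemor2015, §2 and Cor. 5] -/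
theorem expander_erasureThreshold (H : ∀ i, Matrix (B i) (A i) (ZMod 2)) {dA dB : ℕ}
    {γA δA γB δB : ℝ} (hreg : ∀ i, IsBiregular (H i) dA dB)
    (hexp : ∀ i, IsLeftRightExpanding (H i) dA dB γA δA γB δB) (hdA : 0 < dA) (hdB : 0 < dB)
    (hγA : 0 < γA) (hγB : 0 < γB) (hδA : δA < 1 / 2) (hδB : δB < 1 / 2)
    (hgrow : Tendsto (fun i => Fintype.card (A i)) atTop atTop)
    {y : ℝ} (hy0 : 0 ≤ y) (hy : ((dA + dB - 1 : ℕ) : ℝ) * y < 1) :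
    Tendsto (fun i => ErasureDecoder.uncorrectableProb
      {x : (A i × A i) ⊕ (B i × B i) → ZMod 2 | expanderHX (H i) *ᵥ x = 0}
      (rowSpace (expanderHZ (H i)) : Set ((A i × A i) ⊕ (B i × B i) → ZMod 2)) y) atTop (𝓝 0) :=
  erasureThreshold_of_rowWeight' (fun i => expanderHX (H i)) (fun i => rowSpace (expanderHZ (H i)))
    (w := dA + dB) (by omega) (fun i j => card_rowSupp_expanderHX_le (H i) (hreg i) j)
    (fun i => (⌊min (γA * Fintype.card (A i)) (γB * Fintype.card (B i))⌋₊ + 1)) (fun _ => Nat.succ_pos _)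
    (fun i x hx hnot => dist_le_hammingNorm (H i) (hreg i) hdA hdB (hexp i) hδA hδB x hx hnot)
    (fun _ hr0 hr1 => tendsto_card_mul_pow_dist H hreg hdA hdB hγA hγB hgrow hr0 hr1) hy0 hy

/-- **Certified phenomenological threshold of every quantum expander family** (syndrome bits flipped with
probability `q = p`, `T_i ≤ M n_A(i)^m` rounds, EVERY family of minimum-weight space-time decoders): with
the same hypotheses, `4(Δ_A+Δ_B+1)² p(1−p) < 1` (i.e. `p < p₀(Δ_A+Δ_B+1)`) ⇒ `Prob_fail → 0`.
PROVED, unconditional.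
[cite: DumerKovalevPryadko2015, Thm 3 with p. 5 (w → w + 2; w = Δ_A + Δ_B)] [cite: LeverrierTillichZemor2015, §2 and Cor. 5] -/
theorem expander_phenomThreshold (H : ∀ i, Matrix (B i) (A i) (ZMod 2)) {dA dB : ℕ}
    {γA δA γB δB : ℝ} (hreg : ∀ i, IsBiregular (H i) dA dB)
    (hexp : ∀ i, IsLeftRightExpanding (H i) dA dB γA δA γB δB) (hdA : 0 < dA) (hdB : 0 < dB)
    (hγA : 0 < γA) (hγB : 0 < γB) (hδA : δA < 1 / 2) (hδB : δB < 1 / 2)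
    (hgrow : Tendsto (fun i => Fintype.card (A i)) atTop atTop)
    (T : ℕ → ℕ) {M : ℝ} {m : ℕ} (hM : 0 ≤ M) (hT : ∀ i, (T i : ℝ) ≤ M * (Fintype.card (A i) : ℝ) ^ m)
    (D : ∀ i, CSSPhenom.STDecoder (A i × B i) ((A i × A i) ⊕ (B i × B i)) (T i))
    (hD : ∀ i, (D i).IsMinWeight (CSSPhenom.stSyn (expanderHX (H i)) (T i))
      (CSSPhenom.stCycles (expanderHX (H i)) (T i)) hammingNorm)
    {p : ℝ} (hp0 : 0 ≤ p) (hp : p ≤ 1 / 2)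
    (h4 : 4 * ((dA + dB + 1 : ℕ) : ℝ) ^ 2 * (p * (1 - p)) < 1) :
    Tendsto (fun i => CSSPhenom.phenomFailureProb (expanderHX (H i)) (T i)
      (rowSpace (expanderHZ (H i)) : Set ((A i × A i) ⊕ (B i × B i) → ZMod 2)) (D i) p p)
      atTop (𝓝 0) :=
  phenomThreshold_of_rowWeight' (fun i => expanderHX (H i)) (fun i => rowSpace (expanderHZ (H i))) T D hD
    (w := dA + dB) (fun i j => card_rowSupp_expanderHX_le (H i) (hreg i) j)
    (fun i => (⌊min (γA * Fintype.card (A i)) (γB * Fintype.card (B i))⌋₊ + 1)) (fun _ => Nat.succ_pos _)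
    (fun i x hx hnot => dist_le_hammingNorm (H i) (hreg i) hdA hdB (hexp i) hδA hδB x hx hnot)
    (fun _ hr0 hr1 => tendsto_card_mul_rounds_mul_pow_dist H hreg hdA hdB hγA hγB hgrow T hM hT hr0 hr1)
    hp0 hp h4

end QuantumExpander

end Literature.InformationTheory.QuantumCodes
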